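/-
Origin: expansion seat `planner-pub-hodgecm-mc-axioms-1-g14-0`, handover #W59 2026-08-20T15:53:55Z md5 6dd6e75e6ebe (PKG b65c55f7e9b2 → 6dd6e75e6ebe; 361 l.; MECHANICAL (iib-R) rewrite v3.1 of the PKG file as it stands (38 token edits; rules R1x1+RX[h₂']x37)) (`HOME/mc/pub-hodgecm-mc-axioms-1-g14/revendor/kit-r55/stage55/HodgeCM/Model/ArchKTypeOfSideChar.lean`, md5 6dd6e75e6ebe, 361 lines);
landed by the gen-22 packager (p-g22) in gate run 55 REPLACES the earlier landed copy of `HodgeCM/Model/ArchKTypeOfSideChar.lean` (seat copy carried the packager Origin header of an earlier run (stripped)).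
-/
/-
Copyright (c) 2026. Released under Apache 2.0 license as described in the file LICENSE.
Cell pub-hodgecm, MODEL layer (construction prover mc-carch-1, gen 3), (C-LINE1) RULING SUPPLEMENT 4 (R1): GENERIC RE-CUT of
`Model/ArchKTypeOfSide (#CA19)` over the character-generic S pin term `archSideOfChar … η₀ η₁ η₂ η₃ hmaj hrat A` (`Model/ArchSideOfChar`).
Every by-name declaration `X` of the original (typed at period-1's `archSideOf … η hη hηc h₁W A`, default η-split) reappears here as `XG`
with `archSideOf ↦ archSideOfChar`, `etaₖ V c.D η ↦ ηₖ`, `lineRepD … η ↦ lineRepOf … η₀ η₁ η₂ η₃`, proofs verbatim; the generic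
declarations of the original are imported, not restated.  At `(η₀,…,η₃) := (eta₀,…,eta₃) V c.D η` the `…G` terms are the originals
(`archSideOf_eq_archSideOfChar`, `rfl`); at period-1's R1 split `(etaT₀ η ν, etaT₁ η ν, eta₂ η, eta₃ η)` they serve `archSideOfT`.
Nothing is cited here and nothing is minted: 0 records, 0 `def … : Prop`.
-/
import Summits.HodgeConjecture.HodgeCM.Model.ArchKTypeOfOrient
import Summits.HodgeConjecture.HodgeCM.Model.ArchKTypeOfSide
import Summits.HodgeConjecture.HodgeCM.Model.ArchKTypeOfSlotRecChar
import Summits.HodgeConjecture.HodgeCM.Model.ThetaAdelicSideInstance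

/-! PORT of `HodgeCM/Model/ArchKTypeOfSideChar.lean` (HodgeCMPerL run 82) — verbatim mechanical port; provenance in the PORT header line. -/



set_option autoImplicit false

noncomputable section

open Filter Topology Complex
open NumberField NumberField.InfinitePlace NumberField.mixedEmbedding IsDedekindDomain MeasureTheory
open scoped Matrix TensorProduct Classical SchwartzMap
open MulAction
open Literature.Geometry.ComplexHyperbolic.BallModel (U21 x₀ stabilizerEquivK21)
open Literature.NumberTheory.Automorphic.U21 (K21 matA sclD)
open Literature.AlgebraicGeometry.HodgeTheory
open Literature.AlgebraicGeometry.ShimuraVarieties Literature.AlgebraicGeometry.ShimuraVarieties.BallForms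
open Literature.NumberTheory.Automorphic Literature.NumberTheory.Weil1964
open Literature.RepresentationTheory.KonnoKonno2007 Literature.RepresentationTheory.KonnoKonno2007.RealDualPair
open Literature.NumberTheory.GelbartRogawski1991 Literature.NumberTheory.GelbartRogawski1991.UnitaryDualPair
open Literature.Analysis.SegalBargmann Literature.Analysis.Distribution
open Literature.NumberTheory.Automorphic.PicardCM
open HodgeCM.Adelic HodgeCM.PerL34 HodgeCM.Model.HypCensus HodgeCM.Model.SupplyInstance HodgeCM.Model.ArchSideTerm

namespace HodgeCM.Model
section Side

variable (hHD : exists_isReal_hodgeModel) (hI : hodgePQ_independent_of_hodgeModel)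
  (h₁ : BallQuotientUniformised)  (h₃ : CMAbelianVarietyRealised)

variable {L : CMField} {ι₁ : L →+* ℂ} (V : HermSpace3 L ι₁) (c : SeesawCtx L) (S : ThetaAdelicSide V c)
  (hGR : (cmSplittingDatum (L : Type) finProdFinEquiv (frameD V) (frameD_real V) (frameD_ne V) (dW c.D) (dW_real c.D)
    (dW_ne c.D)).CompatibleSplitting)
  (hGR₀ : (cmSplittingDatum (L : Type) (e₁) (frameD V) (frameD_real V) (frameD_ne V) (lineVec (L : Type) (dW c.D 0))
    (fun _ => dW_real c.D 0) (fun _ => dW_ne c.D 0)).CompatibleSplitting)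
  (hGR₁ : (cmSplittingDatum (L : Type) (e₁) (frameD V) (frameD_real V) (frameD_ne V) (lineVec (L : Type) (dW c.D 1))
    (fun _ => dW_real c.D 1) (fun _ => dW_ne c.D 1)).CompatibleSplitting)
  (hGR₂ : (cmSplittingDatum (L : Type) (e₁) (frameD V) (frameD_real V) (frameD_ne V) (lineVec (L : Type) (dW' c.D 0))
    (fun _ => dW'_real c.D 0) (fun _ => dW'_ne c.D 0)).CompatibleSplitting)
  (hGR₃ : (cmSplittingDatum (L : Type) (e₁) (frameD V) (frameD_real V) (frameD_ne V) (lineVec (L : Type) (dW' c.D 1))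
    (fun _ => dW'_real c.D 1) (fun _ => dW'_ne c.D 1)).CompatibleSplitting)
  (η₀ η₁ η₂ η₃ : CMAdelic (L : Type) (frameD V) × CMAdelicOne (L : Type) →* ℂˣ)
  (hmaj : ∀ k : Fin 4, HasThetaMajorants fun (p : ↥(regimeSubgroup L V.Hm) × ↥(NumberField.relNormOneIdeles (↥(maximalRealSubfield L)) L))
      (φ : piSchwartzBruhat (↥(maximalRealSubfield L)) (Fin 3)) => lineRepOf V c.D hGR hGR₀ hGR₁ hGR₂ hGR₃ η₀ η₁ η₂ η₃ k p φ)
  (hrat : ∀ k : Fin 4, ∀ γ ∈ (V.latticeModel printFact_unitaryCompact_holds).Γ,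
      ∀ t ∈ NumberField.relNormOneRat (↥(maximalRealSubfield L)) L,
        lineRepOf V c.D hGR hGR₀ hGR₁ hGR₂ hGR₃ η₀ η₁ η₂ η₃ k (γ, t) ∈ thetaStabilizerEnd (↥(maximalRealSubfield L)) (Fin 3))
  (h₁W : (∀ j, 0 < (ι₁ (dW c.D j)).re) ∨ ∀ j, (ι₁ (dW c.D j)).re < 0)
  (A : ∀ k : Fin 4, ArchLineInput V (lineRepOf V c.D hGR hGR₀ hGR₁ hGR₂ hGR₃ η₀ η₁ η₂ η₃ k))
  (e : S = archSideOfChar V c hGR hGR₀ hGR₁ hGR₂ hGR₃ η₀ η₁ η₂ η₃ hmaj hrat A)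
  (hV : IsAnisotropic L V.Hm) (hemb : (InfinitePlace.mk ι₁).embedding = ι₁)
  (hpos₀ : 0 < cmXW (L : Type) (frameD V) (lineVec (L : Type) (dW c.D 0)) (fun _ => dW_real c.D 0) ι₁ (HypCensus.cmPlace (L : Type) ι₁) 0)
  (hpos₁ : 0 < cmXW (L : Type) (frameD V) (lineVec (L : Type) (dW c.D 1)) (fun _ => dW_real c.D 1) ι₁ (HypCensus.cmPlace (L : Type) ι₁) 0)

/-- `hlevel` for every side and level (= #CA17 `hlevel_of_side`; restated to keep this file independent of `SA`). -/
theorem hlevel_of_sideCG (Γ₀ : Level V) :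
    ∀ δ ∈ levelImage hHD hI h₁ h₃ Γ₀ hV, ∃ x : (V.latticeModel printFact_unitaryCompact_holds).G,
      x ∈ (satLevelRegimeOf V hV Γ₀.K : Subgroup (V.latticeModel printFact_unitaryCompact_holds).G) ∧
        (archSideOfChar V c hGR hGR₀ hGR₁ hGR₂ hGR₃ η₀ η₁ η₂ η₃ hmaj hrat A).ιinf δ * x ∈ (V.latticeModel printFact_unitaryCompact_holds).Γ := by
  intro δ hδ
  obtain ⟨x, hx, hΓ, -⟩ := ThetaAdelicSide.exists_corrector_of_mem_levelImage hHD hI h₁ h₃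
    (archSideOfChar V c hGR hGR₀ hGR₁ hGR₂ hGR₃ η₀ η₁ η₂ η₃ hmaj hrat A) Γ₀ hV δ hδ
  exact ⟨x, hx, hΓ⟩

/-! ## § 2 Line 0 at a side `S = archSideOf …` -/

section Zero

variable (N : ℕ) (Γ₀ : Level V)
  (arch₀ : linePhi V (dW c.D 0) (dW_real c.D 0) (dW_ne c.D 0) hpos₀ = (A 0).Φinf)
  (harch : ∀ a : UnitaryGroup.arch (↥(maximalRealSubfield L)) L (IsCMField.complexConj L) 3 V.Hm,
    UnitaryGroup.archAt (↥(maximalRealSubfield L)) L (IsCMField.complexConj L) 3 V.Hm (UnitaryGroup.cmPlace (L : Type) ι₁)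
        (NumberField.complexConj_smul_infinitePlace (L : Type) _) (IsCMField.complexConj_ne_one (L : Type)) a = 1 →
    ∀ ℓ, lineRepOf V c.D hGR hGR₀ hGR₁ hGR₂ hGR₃ η₀ η₁ η₂ η₃ 0
        (HodgeCM.Adelic.regimeEquiv L V.Hm hV
          (UnitaryGroup.archToAdelic (↥(maximalRealSubfield L)) L (IsCMField.complexConj L) 3 V.Hm a), 1)
        (testFun (↥(maximalRealSubfield L)) (Fin 3)
          (blockFamilyOfAt (L : Type) e₁ (frameD V) (frameD_real V) (frameD_ne V) (lineVec (L : Type) (dW c.D 0))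
            (fun _ => dW_real c.D 0) (fun _ => dW_ne c.D 0) ι₁ (blockPosEquiv V) (blockNegEquiv V)
            (posIdxEquivUnit hpos₀) (negIdxEquivEmpty hpos₀) (degOnePDual Empty) (binvPi 1) ℓ)
          ((A 0).x₀) N) =
      testFun (↥(maximalRealSubfield L)) (Fin 3)
        (blockFamilyOfAt (L : Type) e₁ (frameD V) (frameD_real V) (frameD_ne V) (lineVec (L : Type) (dW c.D 0))
          (fun _ => dW_real c.D 0) (fun _ => dW_ne c.D 0) ι₁ (blockPosEquiv V) (blockNegEquiv V)
          (posIdxEquivUnit hpos₀) (negIdxEquivEmpty hpos₀) (degOnePDual Empty) (binvPi 1) ℓ)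
        ((A 0).x₀) N)
  (hfin : ∀ kf : UnitaryGroup.finAdelic (↥(maximalRealSubfield L)) L (IsCMField.complexConj L) 3 V.Hm, kf ∈ Γ₀.K →
    ∀ Φinf : 𝓢((Fin 3 → mixedSpace (↥(maximalRealSubfield L))), ℂ),
      lineRepOf V c.D hGR hGR₀ hGR₁ hGR₂ hGR₃ η₀ η₁ η₂ η₃ 0
          (HodgeCM.Adelic.regimeEquiv L V.Hm hV
            (UnitaryGroup.finAdelicToAdelic (↥(maximalRealSubfield L)) L (IsCMField.complexConj L) 3 V.Hm kf), 1)
          (testFun (↥(maximalRealSubfield L)) (Fin 3) Φinf ((A 0).x₀) N) =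
        testFun (↥(maximalRealSubfield L)) (Fin 3) Φinf ((A 0).x₀) N)
  (hχ : ∀ u : stabilizer U21 x₀,
    ((lineScalar_zero V c.D hGR hGR₀ hGR₁ η₀ (u : U21) : ℂˣ) : ℂ) *
        ((matA (stabilizerEquivK21.symm u)).det ^
            (lineVacExponentsZero V c hGR₀ h₁W (posIdxEquivUnit hpos₀)
              (negIdxEquivEmpty hpos₀)).eP *
          sclD (stabilizerEquivK21.symm u) ^
            (lineVacExponentsZero V c hGR₀ h₁W (posIdxEquivUnit hpos₀)
              (negIdxEquivEmpty hpos₀)).eQ) =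
      star (sclD (stabilizerEquivK21.symm u)))

/-- line 0 of E's `C` at period-1's term (before transport): #CA14 `archKTypeOfSlotZeroRecG` with
`hlevel`/`hsec` DISCHARGED and the slot data of a positive line. -/
def archKTypeOfSideZeroPreG :
    ArchKTypeData (thetaSpaceInputIn hHD hI h₁ h₃
      (archSideOfChar V c hGR hGR₀ hGR₁ hGR₂ hGR₃ η₀ η₁ η₂ η₃ hmaj hrat
        A) hV) 0 N :=
  archKTypeOfSlotZeroRecG hHD hI h₁ h₃ V c hGR hGR₀ hGR₁ hGR₂ hGR₃ η₀ η₁ η₂ η₃ hmaj hrat h₁W A hV N Γ₀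
    (hlevel_of_sideCG hHD hI h₁ h₃ V c hGR hGR₀ hGR₁ hGR₂ hGR₃ η₀ η₁ η₂ η₃ hmaj hrat A hV Γ₀) (binvPi 1)
    (posIdxEquivUnit hpos₀) (negIdxEquivEmpty hpos₀)
    (dotProductEquiv ℂ (Fin 2) (Pi.single 0 1)) arch₀ harch hfin
    (hsec_of_embedding_eq V (lineVec (L : Type) (dW c.D 0)) (fun _ => dW_real c.D 0) (fun _ => dW_ne c.D 0) _ _ hemb) hχ

/-- **LINE 0 OF E's `C` AT THE SIDE `S`** (`e : S = archSideOf …`, canonical representative `hemb`, line 0 positive at `v₁`). -/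
def archKTypeOfSideZeroG :
    ArchKTypeData (thetaSpaceInputIn hHD hI h₁ h₃ S hV) 0 N :=
  ArchKTypeData.castSide hHD hI h₁ h₃
    e.symm
    (archKTypeOfSideZeroPreG hHD hI h₁ h₃ V c hGR hGR₀ hGR₁ hGR₂ hGR₃ η₀ η₁ η₂ η₃ hmaj hrat h₁W A hV hemb hpos₀ N Γ₀ arch₀ harch hfin hχ)

/-- **ROW 14 for line 0 at `S` — no further hypothesis.** -/
theorem isWeaklyPDiff_archKTypeOfSideZeroG :
    (archKTypeOfSideZeroG hHD hI h₁ h₃ V c S hGR hGR₀ hGR₁ hGR₂ hGR₃ η₀ η₁ η₂ η₃ hmaj hrat h₁W A e hV hemb hpos₀ N Γ₀ arch₀ harch hfin hχ).IsWeaklyPDiff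
      BallForms.expP := by
  rw [archKTypeOfSideZeroG, ArchKTypeData.isWeaklyPDiff_castSide_iff]
  exact isWeaklyPDiff_archKTypeOfSlotZeroRecG hHD hI h₁ h₃ V c hGR hGR₀ hGR₁ hGR₂ hGR₃ η₀ η₁ η₂ η₃ hmaj hrat h₁W A hV N Γ₀ (hlevel_of_sideCG hHD hI h₁ h₃ V c hGR hGR₀ hGR₁ hGR₂ hGR₃ η₀ η₁ η₂ η₃ hmaj hrat A hV Γ₀) (binvPi 1)
    (posIdxEquivUnit hpos₀) (negIdxEquivEmpty hpos₀) (dotProductEquiv ℂ (Fin 2) (Pi.single 0 1))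
    arch₀ harch hfin (hsec_of_embedding_eq V (lineVec (L : Type) (dW c.D 0)) (fun _ => dW_real c.D 0) (fun _ => dW_ne c.D 0) _ _ hemb) hχ

/-- **ROW 15 for line 0 at `S` along `expP` (Along shape) — no further hypothesis.** -/
theorem isPMinusKilledAlong_archKTypeOfSideZeroG (p : Fin 2) :
    (archKTypeOfSideZeroG hHD hI h₁ h₃ V c S hGR hGR₀ hGR₁ hGR₂ hGR₃ η₀ η₁ η₂ η₃ hmaj hrat h₁W A e hV hemb hpos₀ N Γ₀ arch₀ harch hfin hχ).IsPMinusKilledAlong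
      BallForms.expP (-Complex.I • (Pi.single p 1 : Fin 2 → ℂ)) := by
  rw [archKTypeOfSideZeroG, ArchKTypeData.isPMinusKilledAlong_castSide_iff' hHD hI h₁ h₃ V c]
  exact isPMinusKilledAlong_archKTypeOfSlotZeroRec_of_embedding_eqG hHD hI h₁ h₃ V c hGR hGR₀ hGR₁ hGR₂
    hGR₃ η₀ η₁ η₂ η₃ hmaj hrat h₁W A hV N Γ₀
    (hlevel_of_sideCG hHD hI h₁ h₃ V c hGR hGR₀ hGR₁ hGR₂ hGR₃ η₀ η₁ η₂ η₃ hmaj hrat A hV Γ₀) (binvPi 1) (posIdxEquivUnit hpos₀)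
    (negIdxEquivEmpty hpos₀) (dotProductEquiv ℂ (Fin 2) (Pi.single 0 1)) arch₀ harch hfin
    (hsec_of_embedding_eq V (lineVec (L : Type) (dW c.D 0)) (fun _ => dW_real c.D 0) (fun _ => dW_ne c.D 0) _ _ hemb) hχ hemb p

end Zero

/-! ## § 3 Line 1 at a side `S = archSideOf …` -/

section One

variable (N : ℕ) (Γ₀ : Level V)
  (arch₀ : linePhi V (dW c.D 1) (dW_real c.D 1) (dW_ne c.D 1) hpos₁ = (A 1).Φinf)
  (harch : ∀ a : UnitaryGroup.arch (↥(maximalRealSubfield L)) L (IsCMField.complexConj L) 3 V.Hm,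
    UnitaryGroup.archAt (↥(maximalRealSubfield L)) L (IsCMField.complexConj L) 3 V.Hm (UnitaryGroup.cmPlace (L : Type) ι₁)
        (NumberField.complexConj_smul_infinitePlace (L : Type) _) (IsCMField.complexConj_ne_one (L : Type)) a = 1 →
    ∀ ℓ, lineRepOf V c.D hGR hGR₀ hGR₁ hGR₂ hGR₃ η₀ η₁ η₂ η₃ 1
        (HodgeCM.Adelic.regimeEquiv L V.Hm hV
          (UnitaryGroup.archToAdelic (↥(maximalRealSubfield L)) L (IsCMField.complexConj L) 3 V.Hm a), 1)
        (testFun (↥(maximalRealSubfield L)) (Fin 3)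
          (blockFamilyOfAt (L : Type) e₁ (frameD V) (frameD_real V) (frameD_ne V) (lineVec (L : Type) (dW c.D 1))
            (fun _ => dW_real c.D 1) (fun _ => dW_ne c.D 1) ι₁ (blockPosEquiv V) (blockNegEquiv V)
            (posIdxEquivUnit hpos₁) (negIdxEquivEmpty hpos₁) (degOnePDual Empty) (binvPi 1) ℓ)
          ((A 1).x₀) N) =
      testFun (↥(maximalRealSubfield L)) (Fin 3)
        (blockFamilyOfAt (L : Type) e₁ (frameD V) (frameD_real V) (frameD_ne V) (lineVec (L : Type) (dW c.D 1))
          (fun _ => dW_real c.D 1) (fun _ => dW_ne c.D 1) ι₁ (blockPosEquiv V) (blockNegEquiv V)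
          (posIdxEquivUnit hpos₁) (negIdxEquivEmpty hpos₁) (degOnePDual Empty) (binvPi 1) ℓ)
        ((A 1).x₀) N)
  (hfin : ∀ kf : UnitaryGroup.finAdelic (↥(maximalRealSubfield L)) L (IsCMField.complexConj L) 3 V.Hm, kf ∈ Γ₀.K →
    ∀ Φinf : 𝓢((Fin 3 → mixedSpace (↥(maximalRealSubfield L))), ℂ),
      lineRepOf V c.D hGR hGR₀ hGR₁ hGR₂ hGR₃ η₀ η₁ η₂ η₃ 1
          (HodgeCM.Adelic.regimeEquiv L V.Hm hV
            (UnitaryGroup.finAdelicToAdelic (↥(maximalRealSubfield L)) L (IsCMField.complexConj L) 3 V.Hm kf), 1)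
          (testFun (↥(maximalRealSubfield L)) (Fin 3) Φinf ((A 1).x₀) N) =
        testFun (↥(maximalRealSubfield L)) (Fin 3) Φinf ((A 1).x₀) N)
  (hχ : ∀ u : stabilizer U21 x₀,
    ((lineScalar_one V c.D hGR hGR₀ hGR₁ η₁ (u : U21) : ℂˣ) : ℂ) *
        ((matA (stabilizerEquivK21.symm u)).det ^
            (lineVacExponentsOne V c hGR₁ h₁W (posIdxEquivUnit hpos₁)
              (negIdxEquivEmpty hpos₁)).eP *
          sclD (stabilizerEquivK21.symm u) ^
            (lineVacExponentsOne V c hGR₁ h₁W (posIdxEquivUnit hpos₁)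
              (negIdxEquivEmpty hpos₁)).eQ) =
      star (sclD (stabilizerEquivK21.symm u)))

/-- line 1 of E's `C` at period-1's term (before transport): #CA14 `archKTypeOfSlotOneRecG` with
`hlevel`/`hsec` DISCHARGED and the slot data of a positive line. -/
def archKTypeOfSideOnePreG :
    ArchKTypeData (thetaSpaceInputIn hHD hI h₁ h₃
      (archSideOfChar V c hGR hGR₀ hGR₁ hGR₂ hGR₃ η₀ η₁ η₂ η₃ hmaj hrat
        A) hV) 1 N :=
  archKTypeOfSlotOneRecG hHD hI h₁ h₃ V c hGR hGR₀ hGR₁ hGR₂ hGR₃ η₀ η₁ η₂ η₃ hmaj hrat h₁W A hV N Γ₀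
    (hlevel_of_sideCG hHD hI h₁ h₃ V c hGR hGR₀ hGR₁ hGR₂ hGR₃ η₀ η₁ η₂ η₃ hmaj hrat A hV Γ₀) (binvPi 1)
    (posIdxEquivUnit hpos₁) (negIdxEquivEmpty hpos₁)
    (dotProductEquiv ℂ (Fin 2) (Pi.single 0 1)) arch₀ harch hfin
    (hsec_of_embedding_eq V (lineVec (L : Type) (dW c.D 1)) (fun _ => dW_real c.D 1) (fun _ => dW_ne c.D 1) _ _ hemb) hχ

/-- **LINE 1 OF E's `C` AT THE SIDE `S`** (`e : S = archSideOf …`, canonical representative `hemb`, line 1 positive at `v₁`). -/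
def archKTypeOfSideOneG :
    ArchKTypeData (thetaSpaceInputIn hHD hI h₁ h₃ S hV) 1 N :=
  ArchKTypeData.castSide hHD hI h₁ h₃
    e.symm
    (archKTypeOfSideOnePreG hHD hI h₁ h₃ V c hGR hGR₀ hGR₁ hGR₂ hGR₃ η₀ η₁ η₂ η₃ hmaj hrat h₁W A hV hemb hpos₁ N Γ₀ arch₀ harch hfin hχ)

/-- **ROW 14 for line 1 at `S` — no further hypothesis.** -/
theorem isWeaklyPDiff_archKTypeOfSideOneG :
    (archKTypeOfSideOneG hHD hI h₁ h₃ V c S hGR hGR₀ hGR₁ hGR₂ hGR₃ η₀ η₁ η₂ η₃ hmaj hrat h₁W A e hV hemb hpos₁ N Γ₀ arch₀ harch hfin hχ).IsWeaklyPDiff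
      BallForms.expP := by
  rw [archKTypeOfSideOneG, ArchKTypeData.isWeaklyPDiff_castSide_iff]
  exact isWeaklyPDiff_archKTypeOfSlotOneRecG hHD hI h₁ h₃ V c hGR hGR₀ hGR₁ hGR₂ hGR₃ η₀ η₁ η₂ η₃ hmaj hrat h₁W A hV N Γ₀ (hlevel_of_sideCG hHD hI h₁ h₃ V c hGR hGR₀ hGR₁ hGR₂ hGR₃ η₀ η₁ η₂ η₃ hmaj hrat A hV Γ₀) (binvPi 1)
    (posIdxEquivUnit hpos₁) (negIdxEquivEmpty hpos₁) (dotProductEquiv ℂ (Fin 2) (Pi.single 0 1))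
    arch₀ harch hfin (hsec_of_embedding_eq V (lineVec (L : Type) (dW c.D 1)) (fun _ => dW_real c.D 1) (fun _ => dW_ne c.D 1) _ _ hemb) hχ

/-- **ROW 15 for line 1 at `S` along `expP` (Along shape) — no further hypothesis.** -/
theorem isPMinusKilledAlong_archKTypeOfSideOneG (p : Fin 2) :
    (archKTypeOfSideOneG hHD hI h₁ h₃ V c S hGR hGR₀ hGR₁ hGR₂ hGR₃ η₀ η₁ η₂ η₃ hmaj hrat h₁W A e hV hemb hpos₁ N Γ₀ arch₀ harch hfin hχ).IsPMinusKilledAlong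
      BallForms.expP (-Complex.I • (Pi.single p 1 : Fin 2 → ℂ)) := by
  rw [archKTypeOfSideOneG, ArchKTypeData.isPMinusKilledAlong_castSide_iff' hHD hI h₁ h₃ V c]
  exact isPMinusKilledAlong_archKTypeOfSlotOneRec_of_embedding_eqG hHD hI h₁ h₃ V c hGR hGR₀ hGR₁ hGR₂
    hGR₃ η₀ η₁ η₂ η₃ hmaj hrat h₁W A hV N Γ₀
    (hlevel_of_sideCG hHD hI h₁ h₃ V c hGR hGR₀ hGR₁ hGR₂ hGR₃ η₀ η₁ η₂ η₃ hmaj hrat A hV Γ₀) (binvPi 1) (posIdxEquivUnit hpos₁)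
    (negIdxEquivEmpty hpos₁) (dotProductEquiv ℂ (Fin 2) (Pi.single 0 1)) arch₀ harch hfin
    (hsec_of_embedding_eq V (lineVec (L : Type) (dW c.D 1)) (fun _ => dW_real c.D 1) (fun _ => dW_ne c.D 1) _ _ hemb) hχ hemb p

end One

/-! ## § 4 The `k`-dispatch at the side -/

section Dispatch

variable (N : ℕ) (Γ₀ : Level V)
variable
  (arch₀₀ : linePhi V (dW c.D 0) (dW_real c.D 0) (dW_ne c.D 0) hpos₀ = (A 0).Φinf)
  (harch₀ : ∀ a : UnitaryGroup.arch (↥(maximalRealSubfield L)) L (IsCMField.complexConj L) 3 V.Hm,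
    UnitaryGroup.archAt (↥(maximalRealSubfield L)) L (IsCMField.complexConj L) 3 V.Hm (UnitaryGroup.cmPlace (L : Type) ι₁)
        (NumberField.complexConj_smul_infinitePlace (L : Type) _) (IsCMField.complexConj_ne_one (L : Type)) a = 1 →
    ∀ ℓ, lineRepOf V c.D hGR hGR₀ hGR₁ hGR₂ hGR₃ η₀ η₁ η₂ η₃ 0
        (HodgeCM.Adelic.regimeEquiv L V.Hm hV
          (UnitaryGroup.archToAdelic (↥(maximalRealSubfield L)) L (IsCMField.complexConj L) 3 V.Hm a), 1)
        (testFun (↥(maximalRealSubfield L)) (Fin 3)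
          (blockFamilyOfAt (L : Type) e₁ (frameD V) (frameD_real V) (frameD_ne V) (lineVec (L : Type) (dW c.D 0))
            (fun _ => dW_real c.D 0) (fun _ => dW_ne c.D 0) ι₁ (blockPosEquiv V) (blockNegEquiv V)
            (posIdxEquivUnit hpos₀) (negIdxEquivEmpty hpos₀) (degOnePDual Empty) (binvPi 1) ℓ)
          ((A 0).x₀) N) =
      testFun (↥(maximalRealSubfield L)) (Fin 3)
        (blockFamilyOfAt (L : Type) e₁ (frameD V) (frameD_real V) (frameD_ne V) (lineVec (L : Type) (dW c.D 0))
          (fun _ => dW_real c.D 0) (fun _ => dW_ne c.D 0) ι₁ (blockPosEquiv V) (blockNegEquiv V)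
          (posIdxEquivUnit hpos₀) (negIdxEquivEmpty hpos₀) (degOnePDual Empty) (binvPi 1) ℓ)
        ((A 0).x₀) N)
  (hfin₀ : ∀ kf : UnitaryGroup.finAdelic (↥(maximalRealSubfield L)) L (IsCMField.complexConj L) 3 V.Hm, kf ∈ Γ₀.K →
    ∀ Φinf : 𝓢((Fin 3 → mixedSpace (↥(maximalRealSubfield L))), ℂ),
      lineRepOf V c.D hGR hGR₀ hGR₁ hGR₂ hGR₃ η₀ η₁ η₂ η₃ 0
          (HodgeCM.Adelic.regimeEquiv L V.Hm hV
            (UnitaryGroup.finAdelicToAdelic (↥(maximalRealSubfield L)) L (IsCMField.complexConj L) 3 V.Hm kf), 1)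
          (testFun (↥(maximalRealSubfield L)) (Fin 3) Φinf ((A 0).x₀) N) =
        testFun (↥(maximalRealSubfield L)) (Fin 3) Φinf ((A 0).x₀) N)
  (hχ₀ : ∀ u : stabilizer U21 x₀,
    ((lineScalar_zero V c.D hGR hGR₀ hGR₁ η₀ (u : U21) : ℂˣ) : ℂ) *
        ((matA (stabilizerEquivK21.symm u)).det ^
            (lineVacExponentsZero V c hGR₀ h₁W (posIdxEquivUnit hpos₀)
              (negIdxEquivEmpty hpos₀)).eP *
          sclD (stabilizerEquivK21.symm u) ^
            (lineVacExponentsZero V c hGR₀ h₁W (posIdxEquivUnit hpos₀)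
              (negIdxEquivEmpty hpos₀)).eQ) =
      star (sclD (stabilizerEquivK21.symm u)))
variable
  (arch₀₁ : linePhi V (dW c.D 1) (dW_real c.D 1) (dW_ne c.D 1) hpos₁ = (A 1).Φinf)
  (harch₁ : ∀ a : UnitaryGroup.arch (↥(maximalRealSubfield L)) L (IsCMField.complexConj L) 3 V.Hm,
    UnitaryGroup.archAt (↥(maximalRealSubfield L)) L (IsCMField.complexConj L) 3 V.Hm (UnitaryGroup.cmPlace (L : Type) ι₁)
        (NumberField.complexConj_smul_infinitePlace (L : Type) _) (IsCMField.complexConj_ne_one (L : Type)) a = 1 →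
    ∀ ℓ, lineRepOf V c.D hGR hGR₀ hGR₁ hGR₂ hGR₃ η₀ η₁ η₂ η₃ 1
        (HodgeCM.Adelic.regimeEquiv L V.Hm hV
          (UnitaryGroup.archToAdelic (↥(maximalRealSubfield L)) L (IsCMField.complexConj L) 3 V.Hm a), 1)
        (testFun (↥(maximalRealSubfield L)) (Fin 3)
          (blockFamilyOfAt (L : Type) e₁ (frameD V) (frameD_real V) (frameD_ne V) (lineVec (L : Type) (dW c.D 1))
            (fun _ => dW_real c.D 1) (fun _ => dW_ne c.D 1) ι₁ (blockPosEquiv V) (blockNegEquiv V)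
            (posIdxEquivUnit hpos₁) (negIdxEquivEmpty hpos₁) (degOnePDual Empty) (binvPi 1) ℓ)
          ((A 1).x₀) N) =
      testFun (↥(maximalRealSubfield L)) (Fin 3)
        (blockFamilyOfAt (L : Type) e₁ (frameD V) (frameD_real V) (frameD_ne V) (lineVec (L : Type) (dW c.D 1))
          (fun _ => dW_real c.D 1) (fun _ => dW_ne c.D 1) ι₁ (blockPosEquiv V) (blockNegEquiv V)
          (posIdxEquivUnit hpos₁) (negIdxEquivEmpty hpos₁) (degOnePDual Empty) (binvPi 1) ℓ)
        ((A 1).x₀) N)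
  (hfin₁ : ∀ kf : UnitaryGroup.finAdelic (↥(maximalRealSubfield L)) L (IsCMField.complexConj L) 3 V.Hm, kf ∈ Γ₀.K →
    ∀ Φinf : 𝓢((Fin 3 → mixedSpace (↥(maximalRealSubfield L))), ℂ),
      lineRepOf V c.D hGR hGR₀ hGR₁ hGR₂ hGR₃ η₀ η₁ η₂ η₃ 1
          (HodgeCM.Adelic.regimeEquiv L V.Hm hV
            (UnitaryGroup.finAdelicToAdelic (↥(maximalRealSubfield L)) L (IsCMField.complexConj L) 3 V.Hm kf), 1)
          (testFun (↥(maximalRealSubfield L)) (Fin 3) Φinf ((A 1).x₀) N) =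
        testFun (↥(maximalRealSubfield L)) (Fin 3) Φinf ((A 1).x₀) N)
  (hχ₁ : ∀ u : stabilizer U21 x₀,
    ((lineScalar_one V c.D hGR hGR₀ hGR₁ η₁ (u : U21) : ℂˣ) : ℂ) *
        ((matA (stabilizerEquivK21.symm u)).det ^
            (lineVacExponentsOne V c hGR₁ h₁W (posIdxEquivUnit hpos₁)
              (negIdxEquivEmpty hpos₁)).eP *
          sclD (stabilizerEquivK21.symm u) ^
            (lineVacExponentsOne V c hGR₁ h₁W (posIdxEquivUnit hpos₁)
              (negIdxEquivEmpty hpos₁)).eQ) =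
      star (sclD (stabilizerEquivK21.symm u)))

/-- **E's `C` at the side `S`, `k`-dispatched** (`k = 0 ∨ k = 1`). -/
def archKTypeOfSideG (k : Fin 4) (hk : k = 0 ∨ k = 1) : ArchKTypeData (thetaSpaceInputIn hHD hI h₁ h₃ S hV) k N :=
  if h0 : k = 0 then
    h0.symm ▸ archKTypeOfSideZeroG hHD hI h₁ h₃ V c S hGR hGR₀ hGR₁ hGR₂ hGR₃ η₀ η₁ η₂ η₃ hmaj hrat h₁W A e hV hemb hpos₀ N Γ₀ arch₀₀ harch₀ hfin₀ hχ₀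
  else
    (hk.resolve_left h0).symm ▸
      archKTypeOfSideOneG hHD hI h₁ h₃ V c S hGR hGR₀ hGR₁ hGR₂ hGR₃ η₀ η₁ η₂ η₃ hmaj hrat h₁W A e hV hemb hpos₁ N Γ₀ arch₀₁ harch₁ hfin₁ hχ₁

set_option backward.isDefEq.respectTransparency false in
/-- **ROW 14 for it — no further hypothesis.** -/
theorem isWeaklyPDiff_archKTypeOfSideG (k : Fin 4) (hk : k = 0 ∨ k = 1) :
    (archKTypeOfSideG hHD hI h₁ h₃ V c S hGR hGR₀ hGR₁ hGR₂ hGR₃ η₀ η₁ η₂ η₃ hmaj hrat h₁W A e hV hemb hpos₀ hpos₁ N Γ₀ arch₀₀ harch₀ hfin₀ hχ₀ arch₀₁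
      harch₁ hfin₁ hχ₁ k hk).IsWeaklyPDiff BallForms.expP := by
  unfold archKTypeOfSideG
  split
  · next h0 =>
    subst h0
    exact isWeaklyPDiff_archKTypeOfSideZeroG hHD hI h₁ h₃ V c S hGR hGR₀ hGR₁ hGR₂ hGR₃ η₀ η₁ η₂ η₃ hmaj hrat h₁W A e hV hemb hpos₀ N Γ₀ arch₀₀ harch₀
      hfin₀ hχ₀
  · next h0 =>
    obtain rfl : k = 1 := hk.resolve_left h0
    exact isWeaklyPDiff_archKTypeOfSideOneG hHD hI h₁ h₃ V c S hGR hGR₀ hGR₁ hGR₂ hGR₃ η₀ η₁ η₂ η₃ hmaj hrat h₁W A e hV hemb hpos₁ N Γ₀ arch₀₁ harch₁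
      hfin₁ hχ₁

set_option backward.isDefEq.respectTransparency false in
/-- **ROW 15 for it along `expP` (Along shape) — no further hypothesis.** -/
theorem isPMinusKilledAlong_archKTypeOfSideG (k : Fin 4) (hk : k = 0 ∨ k = 1) (p : Fin 2) :
    (archKTypeOfSideG hHD hI h₁ h₃ V c S hGR hGR₀ hGR₁ hGR₂ hGR₃ η₀ η₁ η₂ η₃ hmaj hrat h₁W A e hV hemb hpos₀ hpos₁ N Γ₀ arch₀₀ harch₀ hfin₀ hχ₀ arch₀₁
      harch₁ hfin₁ hχ₁ k hk).IsPMinusKilledAlong BallForms.expP (-Complex.I • (Pi.single p 1 : Fin 2 → ℂ)) := by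
  unfold archKTypeOfSideG
  split
  · next h0 =>
    subst h0
    exact isPMinusKilledAlong_archKTypeOfSideZeroG hHD hI h₁ h₃ V c S hGR hGR₀ hGR₁ hGR₂ hGR₃ η₀ η₁ η₂ η₃ hmaj hrat h₁W A e hV hemb hpos₀ N Γ₀ arch₀₀
      harch₀ hfin₀ hχ₀ p
  · next h0 =>
    obtain rfl : k = 1 := hk.resolve_left h0
    exact isPMinusKilledAlong_archKTypeOfSideOneG hHD hI h₁ h₃ V c S hGR hGR₀ hGR₁ hGR₂ hGR₃ η₀ η₁ η₂ η₃ hmaj hrat h₁W A e hV hemb hpos₁ N Γ₀ arch₀₁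
      harch₁ hfin₁ hχ₁ p

end Dispatch

end Side

end HodgeCM.Model

end
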